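import Literature.Probability.RandomPlanarGeometry.SAWIrreducibleBridgeSpanTwoSecondClass
import HarnessLib

/-!
# The second axis class of the span-two cell, II: the planted-skeleton count and the reduction of (L2′) to two sums over skeletons

Topic `Literature/Probability/RandomPlanarGeometry` (sequel of `SAWIrreducibleBridgeSpanTwoSecondClass.lean`; uses the planted-pattern device of
`SAWCountZdPlantedPatternCounts.lean` — master formula over all canonical words `card_filter_eq_sum_numAxes`, falling-factorial extraction
`card_canonical_numAxes_eq_coeff` — and the tree's cost census `costCoeffZd_eq_sum_choose_mul` (`N_{c,n} = Σ_u C(d,u)·F_{c,n}(u)`),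
`costCoeffZd_eq_card_qb`, `card_qb_eq_mul`, `card_allAxesClass_eq_zero_of_lt`).

PRINTED CONTEXT (locators only; nothing quoted). Madras–Slade (1993) §4.2 eq. (4.2.20)–(4.2.22) p. 94, §1.2 p. 10, §1.1 eq. (1.1.8) p. 5.
NOT IN PRINT (lane statements): everything below.

THE COUNT. A skeleton word with the local exclusions is built letter by letter: the first letter is free (`2D` choices), the letters at
`p, q, r` are forced, and a lateral letter avoids the axis of the first letter and — when it has a SOURCE (`src`: the previous position if
lateral, or the far corner of one of the four vertical unit squares) — the reverse of the source letter: `2(D−1)` or `2(D−1) − 1` choices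
(`kappa`). So `#{local family} = Σ_{skeletons} ∏_t kappa_t` (`card_qLoc`), an explicit polynomial `locPoly` in `D` whose top two coefficients are
`2^{n−2}·#skels` and `−2^{n−3}·Σ_skel (2(n−3) + bCount)` (`bCount` = number of lateral positions with a source). The bridge class `QB c` and
the local family have the same canonical words with `≥ c − 2` axes (part I), the master formula expands `#{QB c}` in falling factorials of
`D` with the axis classes `2F_{c,c+2}(u)/u!` as coefficients (`card_qb_eq_sum_descFactorial`), and comparing the two expansions
(`eq_coeff_of_sum_descFactorial_rat`) gives the SECOND axis class as a combination of two finite sums over skeletons.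

THIS FILE (lane «pcv-sawmu», a-p1 g21; all PROVED, standard axioms; tool notions `src`, `Sat`, `OKUpTo`, `SatLast`, `kappa`, `skels`, `QLoc`,
`IsVert`, `cval`, `monicF`, `kappaPoly`, `skelPoly`, `bCount`, `locPoly`, `axisClassCard` — not notions in print):
* sequential counting: ★ `card_snoc_const`, `okUpTo_succ_iff`, `card_satLast`, ★★ `card_okUpTo` (`#{OKUpTo T} = ∏_{t<T} kappa t`),
  ★ `okUpTo_iff_isSkel_localOK`;
* the local family: `qLoc_iff_canon` (type invariant), `IsSkel.unique`, ★ `card_qLoc`, `numAxes_le_of_qLoc`, ★★ `qb_iff_qLoc`;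
* the polynomial: `eval_skelPoly`, ★ `coeff_skelPoly` (`2^{n−2}`, `−2^{n−3}(2(n−3) + bCount)`), `eval_locPoly`, `coeff_locPoly`,
  ★★ `card_canonical_qLoc` (the two top canonical counts of the local family);
* the bridge side: ★ `card_qb_eq_sum_descFactorial`, `eq_coeff_of_sum_descFactorial_rat`, ★★ `axisClassCard_eq_card_canonical`
  (`2F_{c,c+2}(c−3)/(c−3)! = #{canonical τ : QB c τ, numAxes τ = c−2}`), ★★★ `axisClassCard_second_eq_skeleton_sums`:
  `2F_{c,c+2}(c−3)/(c−3)! = C(n−2,2)·2^{n−2}·#skels(n) − 2^{n−3}·Σ_{skels(n)}(2(n−3) + bCount)` (`n = c+1`, `c ≥ 4`) — (L2′) up to the two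
  finite sums `#skels(n) = C(n−2,3)` and `Σ bCount` (the sequel; the lane's enumeration confirms the resulting `F_{c,c+2}(c−3)` =
  `2, 128, 4464, 127488, …` = `(c−3)!·2^{c−3}·(c⁵−12c⁴+59c³−162c²+276c−234)/6` for `c = 4…14`).
[cite: MadrasSlade1993, §4.2 eq. (4.2.20)–(4.2.22) (p. 94); §1.2 (p. 10); §1.1 eq. (1.1.8) p. 5]

Provenance: lane «pcv-sawmu», a-p1 g21 (2026-08-27).
-/

noncomputable section

open Finset
open scoped BigOperators
open Literature.Probability.LatticeModels
open Literature.Probability.RandomPlanarGeometry.SAW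
open Literature.Probability.Percolation

namespace Literature.Probability.RandomPlanarGeometry.SAW.Zd

namespace WordTypes




variable {D : ℕ}

/-! ### One-step counting with a constant number of admissible letters -/

/-- ★ Appending one letter under a constraint that admits the same number `κ` of letters after every admissible prefix multiplies the
count by `κ`. [cite: MadrasSlade1993, §1.2 (p. 10); lane lemma] -/
theorem card_snoc_const {L : ℕ} (P : Word L D → Prop) [DecidablePred P] (R : Word L D → Idx D → Prop) [∀ w, DecidablePred (R w)]
    (κ : ℕ) (hκ : ∀ w, P w → (Finset.univ.filter (R w)).card = κ) :
    (Finset.univ.filter fun w : Word (L + 1) D => P (Fin.init w) ∧ R (Fin.init w) (w (Fin.last L))).card =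
      κ * (Finset.univ.filter P).card := by
  classical
  set S := Finset.univ.filter fun w : Word (L + 1) D => P (Fin.init w) ∧ R (Fin.init w) (w (Fin.last L)) with hS
  have hmaps : ∀ w ∈ S, Fin.init w ∈ Finset.univ.filter P := fun w hw =>
    Finset.mem_filter.2 ⟨Finset.mem_univ _, (Finset.mem_filter.1 hw).2.1⟩
  rw [Finset.card_eq_sum_card_fiberwise hmaps]
  have hfib : ∀ v ∈ Finset.univ.filter P, (S.filter fun w => Fin.init w = v).card = κ := by
    intro v hv
    have hPv : P v := (Finset.mem_filter.1 hv).2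
    have himg : (S.filter fun w => Fin.init w = v) = (Finset.univ.filter (R v)).image fun a => (Fin.snoc v a : Word (L + 1) D) := by
      ext w
      simp only [hS, Finset.mem_filter, Finset.mem_univ, true_and, Finset.mem_image]
      constructor
      · rintro ⟨⟨-, hR⟩, hwv⟩
        refine ⟨w (Fin.last L), by rw [← hwv]; exact hR, by rw [← hwv, Fin.snoc_init_self]⟩
      · rintro ⟨a, ha, rfl⟩
        rw [Fin.init_snoc, Fin.snoc_last]
        exact ⟨⟨hPv, ha⟩, rfl⟩
    rw [himg, Finset.card_image_of_injective _ (fun a b hab => by simpa using congrFun hab (Fin.last L)), hκ v hPv]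
  rw [Finset.sum_congr rfl hfib, Finset.sum_const, smul_eq_mul, mul_comm]

/-! ### Letter specifications for the skeleton words -/

/-- The specification of position `t` of a skeleton word with vertical letters at `0, p, q, r` (lane tool notion):
`0` — free; `p`, `r` — the first letter again; `q` — its reverse; otherwise LATERAL (off the axis of the first letter), avoiding the reverse
of the letter at the SOURCE position when there is one: the previous position if it is lateral, else the far corner of a vertical unit
square (`p−1` for `t = p+1` when `q = p+2`, `q−1` for `t = q+1` when `q = p+2` or `r = q+2`, `q+1` for `t = r+1` when `r = q+2`).
[cite: MadrasSlade1993, §4.2 (p. 94); §1.1 (p. 3); lane tool notion] -/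
def src (p q r t : ℕ) : Option ℕ :=
  if 2 ≤ t ∧ t - 1 ≠ p ∧ t - 1 ≠ q ∧ t - 1 ≠ r then some (t - 1)
  else if t = p + 1 ∧ q = p + 2 ∧ 2 ≤ p then some (p - 1)
  else if t = q + 1 ∧ (q = p + 2 ∨ r = q + 2) then some (q - 1)
  else if t = r + 1 ∧ r = q + 2 then some (q + 1)
  else none

/-- A source is an earlier position. [cite: MadrasSlade1993, §4.2 (p. 94); lane plumbing] -/
theorem src_lt {p q r t s : ℕ} (hadm : 1 ≤ p ∧ p + 2 ≤ q ∧ q + 2 ≤ r) (h : src p q r t = some s) : s < t := by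
  obtain ⟨h1p, -, -⟩ := hadm
  unfold src at h
  split_ifs at h with h1 h2 h3 h4 <;> simp only [Option.some.injEq] at h <;> omega

/-- The constraint at position `t` of a word (`t < T`): free at `0`, the first letter again at `p`, `r`, its reverse at `q`, otherwise a
lateral letter avoiding the reverse of the letter at the source position. [cite: MadrasSlade1993, §4.2 (p. 94); lane tool notion] -/
abbrev Sat (p q r : ℕ) {T : ℕ} (w : Word T D) (t : Fin T) : Prop :=
  t.val = 0 ∨ (t.val ≠ 0 ∧
    ((t.val = p ∨ t.val = r) ∧ w t = w ⟨0, t.pos⟩ ∨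
     t.val = q ∧ w t = revIdx (w ⟨0, t.pos⟩) ∨
     (t.val ≠ p ∧ t.val ≠ q ∧ t.val ≠ r) ∧ (w t).1 ≠ (w ⟨0, t.pos⟩).1 ∧
       ∀ s : Fin T, s.val < t.val → src p q r t.val = some s.val → w t ≠ revIdx (w s)))

/-- All positions satisfy their constraints. [cite: MadrasSlade1993, §4.2 (p. 94); lane tool notion] -/
abbrev OKUpTo (p q r T : ℕ) (w : Word T D) : Prop := ∀ t : Fin T, Sat p q r w t

/-- The constraint on an appended letter, read on the old word. [cite: MadrasSlade1993, §4.2 (p. 94); lane tool notion] -/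
abbrev SatLast (p q r L : ℕ) (v : Word L D) (a : Idx D) : Prop :=
  L = 0 ∨ (L ≠ 0 ∧
    ((L = p ∨ L = r) ∧ (∀ h : 0 < L, a = v ⟨0, h⟩) ∨
     L = q ∧ (∀ h : 0 < L, a = revIdx (v ⟨0, h⟩)) ∨
     (L ≠ p ∧ L ≠ q ∧ L ≠ r) ∧ (∀ h : 0 < L, a.1 ≠ (v ⟨0, h⟩).1) ∧ ∀ s : Fin L, src p q r L = some s.val → a ≠ revIdx (v s)))

/-- Letters of `Fin.snoc v a` below the end. [cite: MadrasSlade1993, §1.2 (p. 10); lane plumbing] -/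
theorem snoc_apply_fin {L : ℕ} (v : Word L D) (a : Idx D) (s : Fin (L + 1)) (hs : s.val < L) :
    (Fin.snoc v a : Word (L + 1) D) s = v ⟨s.val, hs⟩ := by
  obtain ⟨sv, hsv⟩ := s
  exact snoc_apply_lt v a hs

/-- Old positions keep their constraints after appending. [cite: MadrasSlade1993, §4.2 (p. 94); lane plumbing] -/
theorem sat_snoc_castSucc (p q r : ℕ) {L : ℕ} (v : Word L D) (a : Idx D) (t : Fin L) :
    Sat p q r (Fin.snoc v a : Word (L + 1) D) t.castSucc ↔ Sat p q r v t := by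
  have hT := t.2
  have e0 : (Fin.snoc v a : Word (L + 1) D) ⟨0, by omega⟩ = v ⟨0, by omega⟩ := snoc_apply_lt v a (by omega)
  have et : (Fin.snoc v a : Word (L + 1) D) t.castSucc = v t := Fin.snoc_castSucc _ _ _
  unfold Sat
  simp only [Fin.val_castSucc, et, e0]
  constructor
  · rintro (h | ⟨h0, h⟩)
    · exact Or.inl h
    · refine Or.inr ⟨h0, ?_⟩
      rcases h with h | h | ⟨h1, h2, h3⟩
      · exact Or.inl h
      · exact Or.inr (Or.inl h)
      · refine Or.inr (Or.inr ⟨h1, h2, fun s hs hsrc => ?_⟩)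
        have := h3 s.castSucc hs hsrc
        rwa [Fin.snoc_castSucc] at this
  · rintro (h | ⟨h0, h⟩)
    · exact Or.inl h
    · refine Or.inr ⟨h0, ?_⟩
      rcases h with h | h | ⟨h1, h2, h3⟩
      · exact Or.inl h
      · exact Or.inr (Or.inl h)
      · refine Or.inr (Or.inr ⟨h1, h2, fun s hs hsrc => ?_⟩)
        rw [snoc_apply_fin v a s (by omega)]
        exact h3 ⟨s.val, by omega⟩ hs hsrc

/-- The appended position's constraint is `SatLast` on the old word. [cite: MadrasSlade1993, §4.2 (p. 94); lane plumbing] -/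
theorem sat_snoc_last (p q r : ℕ) {L : ℕ} (v : Word L D) (a : Idx D) :
    Sat p q r (Fin.snoc v a : Word (L + 1) D) (Fin.last L) ↔ SatLast p q r L v a := by
  have ea : (Fin.snoc v a : Word (L + 1) D) (Fin.last L) = a := Fin.snoc_last _ _
  rcases Nat.eq_zero_or_pos L with hL | hL
  · subst hL
    unfold Sat SatLast
    simp
  · have e0 : (Fin.snoc v a : Word (L + 1) D) ⟨0, by omega⟩ = v ⟨0, hL⟩ := snoc_apply_lt v a hL
    have hL0 : L ≠ 0 := by omega
    unfold Sat SatLast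
    simp only [Fin.val_last, ea, e0]
    constructor
    · rintro (h | ⟨-, h⟩)
      · exact absurd h hL0
      · refine Or.inr ⟨hL0, ?_⟩
        rcases h with ⟨h1, h2⟩ | ⟨h1, h2⟩ | ⟨h1, h2, h3⟩
        · exact Or.inl ⟨h1, fun _ => h2⟩
        · exact Or.inr (Or.inl ⟨h1, fun _ => h2⟩)
        · refine Or.inr (Or.inr ⟨h1, fun _ => h2, fun s hsrc => ?_⟩)
          have := h3 s.castSucc s.2 hsrc
          rwa [Fin.snoc_castSucc] at this
    · rintro (h | ⟨-, h⟩)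
      · exact absurd h hL0
      · refine Or.inr ⟨hL0, ?_⟩
        rcases h with ⟨h1, h2⟩ | ⟨h1, h2⟩ | ⟨h1, h2, h3⟩
        · exact Or.inl ⟨h1, h2 hL⟩
        · exact Or.inr (Or.inl ⟨h1, h2 hL⟩)
        · refine Or.inr (Or.inr ⟨h1, h2 hL, fun s hs hsrc => ?_⟩)
          rw [snoc_apply_fin v a s hs]
          exact h3 ⟨s.val, hs⟩ hsrc

/-- ★ The prefix structure: `OKUpTo (L+1) w ↔ OKUpTo L (init w) ∧ SatLast L (init w) (w last)`. [cite: MadrasSlade1993, §4.2 (p. 94); lane lemma] -/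
theorem okUpTo_succ_iff (p q r : ℕ) {L : ℕ} (w : Word (L + 1) D) :
    OKUpTo p q r (L + 1) w ↔ OKUpTo p q r L (Fin.init w) ∧ SatLast p q r L (Fin.init w) (w (Fin.last L)) := by
  conv_lhs => rw [← Fin.snoc_init_self w]
  constructor
  · intro h
    exact ⟨fun t => (sat_snoc_castSucc p q r _ _ t).1 (h t.castSucc), (sat_snoc_last p q r _ _).1 (h (Fin.last L))⟩
  · rintro ⟨h1, h2⟩ t
    rcases Fin.eq_castSucc_or_eq_last t with ⟨t', rfl⟩ | rfl
    · exact (sat_snoc_castSucc p q r _ _ t').2 (h1 t')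
    · exact (sat_snoc_last p q r _ _).2 h2

/-! ### The number of admissible letters at each position -/

/-- Letters off a given axis: `2(D − 1)` of them. [cite: MadrasSlade1993, §1.2 (p. 10); lane plumbing] -/
theorem card_filter_fst_ne (x : Fin D) : (Finset.univ.filter fun a : Idx D => a.1 ≠ x).card = 2 * (D - 1) := by
  classical
  have : (Finset.univ.filter fun a : Idx D => a.1 ≠ x) = (Finset.univ.erase x) ×ˢ (Finset.univ : Finset Bool) := by
    ext a; simp [Finset.mem_product, and_comm]
  rw [this, Finset.card_product, Finset.card_erase_of_mem (Finset.mem_univ x), Finset.card_univ, Fintype.card_fin, Finset.card_univ,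
    Fintype.card_bool, mul_comm]

/-- Letters off a given axis and different from one given such letter: `2(D − 1) − 1`. [cite: MadrasSlade1993, §1.2 (p. 10); lane plumbing] -/
theorem card_filter_fst_ne_and_ne (x : Fin D) (b : Idx D) (hb : b.1 ≠ x) :
    (Finset.univ.filter fun a : Idx D => a.1 ≠ x ∧ a ≠ b).card = 2 * (D - 1) - 1 := by
  classical
  have : (Finset.univ.filter fun a : Idx D => a.1 ≠ x ∧ a ≠ b) = (Finset.univ.filter fun a : Idx D => a.1 ≠ x).erase b := by
    ext a; simp [Finset.mem_erase, and_comm]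
  rw [this, Finset.card_erase_of_mem (by simp [hb]), card_filter_fst_ne]

/-- The number of admissible letters at position `L` (after any admissible prefix): `2D` at `0`, `1` at `p, q, r`, `2(D−1)` at a lateral position
without source, `2(D−1) − 1` at a lateral position with a source. [cite: MadrasSlade1993, §4.2 (p. 94); lane tool notion] -/
def kappa (D p q r L : ℕ) : ℕ :=
  if L = 0 then 2 * D else if L = p ∨ L = q ∨ L = r then 1 else if src p q r L = none then 2 * (D - 1) else 2 * (D - 1) - 1

/-- ★ After an admissible prefix of length `L` (admissible skeleton data), exactly `kappa D p q r L` letters may be appended.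
[cite: MadrasSlade1993, §4.2 (p. 94); lane lemma] -/
theorem card_satLast {p q r : ℕ} (hadm : 1 ≤ p ∧ p + 2 ≤ q ∧ q + 2 ≤ r) {L : ℕ} (v : Word L D) (hv : OKUpTo p q r L v) :
    (Finset.univ.filter fun a : Idx D => SatLast p q r L v a).card = kappa D p q r L := by
  classical
  unfold kappa
  rcases Nat.eq_zero_or_pos L with hL | hL
  · subst hL
    rw [if_pos rfl]
    have : (Finset.univ.filter fun a : Idx D => SatLast p q r 0 v a) = Finset.univ := Finset.filter_true_of_mem fun a _ => Or.inl rfl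
    rw [this, Finset.card_univ, Fintype.card_prod, Fintype.card_fin, Fintype.card_bool, mul_comm]
  · rw [if_neg (by omega)]
    have hL0 : L ≠ 0 := by omega
    by_cases hvert : L = p ∨ L = q ∨ L = r
    · rw [if_pos hvert]
      rcases hvert with hp | hq | hr
      · have : (Finset.univ.filter fun a : Idx D => SatLast p q r L v a) = {v ⟨0, hL⟩} := by
          ext a
          simp only [SatLast, Finset.mem_filter, Finset.mem_univ, true_and, Finset.mem_singleton]
          constructor
          · rintro (h | ⟨-, h | h | h⟩)
            · omega
            · exact h.2 hL
            · omega
            · omega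
          · intro h; exact Or.inr ⟨hL0, Or.inl ⟨Or.inl hp, fun _ => h⟩⟩
        rw [this, Finset.card_singleton]
      · have : (Finset.univ.filter fun a : Idx D => SatLast p q r L v a) = {revIdx (v ⟨0, hL⟩)} := by
          ext a
          simp only [SatLast, Finset.mem_filter, Finset.mem_univ, true_and, Finset.mem_singleton]
          constructor
          · rintro (h | ⟨-, h | h | h⟩)
            · omega
            · omega
            · exact h.2 hL
            · omega
          · intro h; exact Or.inr ⟨hL0, Or.inr (Or.inl ⟨hq, fun _ => h⟩)⟩
        rw [this, Finset.card_singleton]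
      · have : (Finset.univ.filter fun a : Idx D => SatLast p q r L v a) = {v ⟨0, hL⟩} := by
          ext a
          simp only [SatLast, Finset.mem_filter, Finset.mem_univ, true_and, Finset.mem_singleton]
          constructor
          · rintro (h | ⟨-, h | h | h⟩)
            · omega
            · exact h.2 hL
            · omega
            · omega
          · intro h; exact Or.inr ⟨hL0, Or.inl ⟨Or.inr hr, fun _ => h⟩⟩
        rw [this, Finset.card_singleton]
    · rw [if_neg hvert]
      push Not at hvert
      obtain ⟨hp, hq, hr⟩ := hvert
      by_cases hsrc : src p q r L = none
      · rw [if_pos hsrc]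
        have : (Finset.univ.filter fun a : Idx D => SatLast p q r L v a) = Finset.univ.filter fun a : Idx D => a.1 ≠ (v ⟨0, hL⟩).1 := by
          ext a
          simp only [SatLast, Finset.mem_filter, Finset.mem_univ, true_and, hsrc]
          constructor
          · rintro (h | ⟨-, h | h | h⟩)
            · omega
            · omega
            · omega
            · exact h.2.1 hL
          · intro h; exact Or.inr ⟨hL0, Or.inr (Or.inr ⟨⟨hp, hq, hr⟩, fun _ => h, fun s hs => by simp at hs⟩)⟩
        rw [this, card_filter_fst_ne]
      · rw [if_neg hsrc]
        obtain ⟨s, hs⟩ := Option.ne_none_iff_exists'.1 hsrc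
        have hsL : s < L := src_lt hadm hs
        -- the source is a lateral position of the admissible prefix, so its letter is off the axis of `v 0`
        have hs1 : 1 ≤ s ∧ s ≠ p ∧ s ≠ q ∧ s ≠ r := by
          unfold src at hs; split_ifs at hs <;> simp only [Option.some.injEq] at hs <;> omega
        have hlat : (v ⟨s, hsL⟩).1 ≠ (v ⟨0, hL⟩).1 := by
          have := hv ⟨s, hsL⟩
          unfold Sat at this
          rcases this with h | ⟨-, h | h | h⟩
          · simp at h; omega
          · simp at h; omega
          · simp at h; omega
          · exact h.2.1
        have : (Finset.univ.filter fun a : Idx D => SatLast p q r L v a) =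
            Finset.univ.filter fun a : Idx D => a.1 ≠ (v ⟨0, hL⟩).1 ∧ a ≠ revIdx (v ⟨s, hsL⟩) := by
          ext a
          simp only [SatLast, Finset.mem_filter, Finset.mem_univ, true_and]
          constructor
          · rintro (h | ⟨-, h | h | h⟩)
            · omega
            · omega
            · omega
            · exact ⟨h.2.1 hL, h.2.2 ⟨s, hsL⟩ hs⟩
          · rintro ⟨h1, h2⟩
            refine Or.inr ⟨hL0, Or.inr (Or.inr ⟨⟨hp, hq, hr⟩, fun _ => h1, fun s' hs' => ?_⟩)⟩
            have : s' = ⟨s, hsL⟩ := Fin.ext (by rw [hs] at hs'; simpa using hs'.symm)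
            rw [this]; exact h2
        rw [this, card_filter_fst_ne_and_ne (v ⟨0, hL⟩).1 (revIdx (v ⟨s, hsL⟩)) (by exact hlat)]

/-- ★★ THE SEQUENTIAL COUNT: the words of length `T` admissible up to `T` number `∏_{t<T} kappa t`. [cite: MadrasSlade1993, §4.2 (p. 94); lane theorem] -/
theorem card_okUpTo {p q r : ℕ} (hadm : 1 ≤ p ∧ p + 2 ≤ q ∧ q + 2 ≤ r) (T : ℕ) :
    (Finset.univ.filter (OKUpTo (D := D) p q r T)).card = ∏ t ∈ Finset.range T, kappa D p q r t := by
  classical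
  induction T with
  | zero =>
    rw [Finset.range_zero, Finset.prod_empty]
    have : (Finset.univ.filter (OKUpTo (D := D) p q r 0)) = Finset.univ :=
      Finset.filter_true_of_mem fun w _ t => t.elim0
    rw [this, Finset.card_univ]
    simp [Word]
  | succ L ih =>
    rw [Finset.prod_range_succ, ← ih, mul_comm]
    rw [show (Finset.univ.filter (OKUpTo (D := D) p q r (L + 1))) =
        Finset.univ.filter fun w : Word (L + 1) D => OKUpTo p q r L (Fin.init w) ∧ SatLast p q r L (Fin.init w) (w (Fin.last L)) from
      Finset.filter_congr fun w _ => okUpTo_succ_iff p q r w]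
    convert card_snoc_const (OKUpTo p q r L) (SatLast p q r L) (kappa D p q r L) fun v hv => card_satLast hadm v hv using 2
    ext w
    simp only [Finset.mem_filter, Finset.mem_univ, true_and]


section SkeletonCount

variable {n D : ℕ}

/-! ### The admissible words of the sequential count are the skeleton words with the local exclusions -/

/-- The four ways a source can arise. [cite: MadrasSlade1993, §4.2 (p. 94); lane plumbing] -/
theorem src_cases {p q r t s : ℕ} (h : src p q r t = some s) :
    (2 ≤ t ∧ t - 1 ≠ p ∧ t - 1 ≠ q ∧ t - 1 ≠ r ∧ s = t - 1) ∨
    (¬ (2 ≤ t ∧ t - 1 ≠ p ∧ t - 1 ≠ q ∧ t - 1 ≠ r) ∧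
      ((t = p + 1 ∧ q = p + 2 ∧ 2 ≤ p ∧ s = p - 1) ∨ (t = q + 1 ∧ (q = p + 2 ∨ r = q + 2) ∧ s = q - 1) ∨
        (t = r + 1 ∧ r = q + 2 ∧ s = q + 1))) := by
  unfold src at h
  split_ifs at h with h1 h2 h3 h4 <;> simp only [Option.some.injEq] at h
  · exact Or.inl ⟨h1.1, h1.2.1, h1.2.2.1, h1.2.2.2, h.symm⟩
  · exact Or.inr ⟨h1, Or.inl ⟨h2.1, h2.2.1, h2.2.2, h.symm⟩⟩
  · exact Or.inr ⟨h1, Or.inr (Or.inl ⟨h3.1, h3.2, h.symm⟩)⟩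
  · exact Or.inr ⟨h1, Or.inr (Or.inr ⟨h4.1, h4.2, h.symm⟩)⟩

/-- Source of a lateral position after a lateral position: the previous position. [cite: MadrasSlade1993, §4.2 (p. 94); lane plumbing] -/
theorem src_succ_of_lateral {p q r i : ℕ} (hi : 1 ≤ i) (hp : i ≠ p) (hq : i ≠ q) (hr : i ≠ r) : src p q r (i + 1) = some i := by
  unfold src
  rw [if_pos ⟨by omega, by simp [hp], by simp [hq], by simp [hr]⟩]
  simp

/-- Source of `p + 1` when `q = p + 2`, `p ≥ 2`. [cite: MadrasSlade1993, §4.2 (p. 94); lane plumbing] -/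
theorem src_p_succ {p q r : ℕ} (hq : q = p + 2) (hp : 2 ≤ p) : src p q r (p + 1) = some (p - 1) := by
  unfold src
  rw [if_neg (by simp), if_pos ⟨rfl, hq, hp⟩]

/-- Source of `q + 1` when `q = p + 2` or `r = q + 2`. [cite: MadrasSlade1993, §4.2 (p. 94); lane plumbing] -/
theorem src_q_succ {p q r : ℕ} (hadm : 1 ≤ p ∧ p + 2 ≤ q ∧ q + 2 ≤ r) (h : q = p + 2 ∨ r = q + 2) : src p q r (q + 1) = some (q - 1) := by
  unfold src
  rw [if_neg (by simp), if_neg (by omega), if_pos ⟨rfl, h⟩]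

/-- Source of `r + 1` when `r = q + 2`. [cite: MadrasSlade1993, §4.2 (p. 94); lane plumbing] -/
theorem src_r_succ {p q r : ℕ} (hadm : 1 ≤ p ∧ p + 2 ≤ q ∧ q + 2 ≤ r) (h : r = q + 2) : src p q r (r + 1) = some (q + 1) := by
  unfold src
  rw [if_neg (by simp), if_neg (by omega), if_neg (by omega), if_pos ⟨rfl, h⟩]

/-- ★ THE ADMISSIBLE WORDS ARE THE SKELETON WORDS WITH THE LOCAL EXCLUSIONS (admissible `p, q, r ≤ n`).
[cite: MadrasSlade1993, §4.2 (p. 94); §1.1 (p. 3); lane lemma] -/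
theorem okUpTo_iff_isSkel_localOK {p q r : ℕ} (hadm : 1 ≤ p ∧ p + 2 ≤ q ∧ q + 2 ≤ r ∧ r ≤ n) (u : Word (n + 1) D) :
    OKUpTo p q r (n + 1) u ↔ IsSkel p q r u ∧ LocalOK p q r u := by
  have hadm3 : 1 ≤ p ∧ p + 2 ≤ q ∧ q + 2 ≤ r := ⟨hadm.1, hadm.2.1, hadm.2.2.1⟩
  have e0 : (⟨0, by omega⟩ : Fin (n + 1)) = 0 := rfl
  constructor
  · intro h
    -- read the letters at `p, q, r`
    have hP : u ⟨p, by omega⟩ = u 0 := by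
      rcases h ⟨p, by omega⟩ with h0 | ⟨-, ⟨-, e⟩ | ⟨e, -⟩ | ⟨⟨e, -⟩, -⟩⟩
      · simp at h0; omega
      · exact e
      · simp at e; omega
      · simp at e
    have hQ : u ⟨q, by omega⟩ = revIdx (u 0) := by
      rcases h ⟨q, by omega⟩ with h0 | ⟨-, ⟨e, -⟩ | ⟨-, e⟩ | ⟨⟨-, e, -⟩, -⟩⟩
      · simp at h0; omega
      · simp at e; omega
      · exact e
      · simp at e
    have hR : u ⟨r, by omega⟩ = u 0 := by
      rcases h ⟨r, by omega⟩ with h0 | ⟨-, ⟨-, e⟩ | ⟨e, -⟩ | ⟨⟨-, -, e⟩, -⟩⟩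
      · simp at h0; omega
      · exact e
      · simp at e; omega
      · simp at e
    -- laterals: axis and source constraints
    have hL : ∀ (t : ℕ) (ht : t < n + 1), t ≠ 0 → t ≠ p → t ≠ q → t ≠ r →
        (u ⟨t, ht⟩).1 ≠ (u 0).1 ∧ ∀ s (hs : s < t), src p q r t = some s → u ⟨t, ht⟩ ≠ revIdx (u ⟨s, by omega⟩) := by
      intro t ht h0 hp hq hr
      rcases h ⟨t, ht⟩ with h0' | ⟨-, ⟨e, -⟩ | ⟨e, -⟩ | ⟨-, hax, hsrc⟩⟩
      · simp at h0'; omega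
      · simp at e; omega
      · simp at e; omega
      · exact ⟨hax, fun s hs e => hsrc ⟨s, by omega⟩ hs e⟩
    refine ⟨⟨hadm, hP, hQ, hR, fun i h0 hp hq hr => (hL i.val i.2 h0 hp hq hr).1⟩, ?_, ?_, ?_, ?_, ?_⟩
    · intro i hi h0 hp hq hr hp' hq' hr'
      exact (hL (i + 1) hi (by omega) hp' hq' hr').2 i (by omega) (src_succ_of_lateral (by omega) hp hq hr)
    · intro hq2 hp2 h'
      have := (hL (p + 1) h' (by omega) (by omega) (by omega) (by omega)).2 (p - 1) (by omega) (src_p_succ hq2 hp2)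
      exact this
    · intro hq2 h'
      have := (hL (q + 1) h' (by omega) (by omega) (by omega) (by omega)).2 (q - 1) (by omega) (src_q_succ hadm3 (Or.inl hq2))
      rw [apply_mk_congr u (show q - 1 = p + 1 by omega)] at this
      exact this
    · intro hr2 h' h1
      exact (hL (q + 1) h' (by omega) (by omega) (by omega) (by omega)).2 (q - 1) (by omega) (src_q_succ hadm3 (Or.inr hr2))
    · intro hr2 h'
      exact (hL (r + 1) h' (by omega) (by omega) (by omega) (by omega)).2 (q + 1) (by omega) (src_r_succ hadm3 hr2)
  · rintro ⟨⟨hadm'', hP, hQ, hR, hoff⟩, c1, c2, c3, c4, c5⟩ t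
    by_cases ht0 : t.val = 0
    · exact Or.inl ht0
    · refine Or.inr ⟨ht0, ?_⟩
      by_cases htp : t.val = p ∨ t.val = r
      · refine Or.inl ⟨htp, ?_⟩
        rcases htp with e | e
        · rw [show t = ⟨p, by omega⟩ from Fin.ext e, hP, ← e0]
        · rw [show t = ⟨r, by omega⟩ from Fin.ext e, hR, ← e0]
      · by_cases htq : t.val = q
        · exact Or.inr (Or.inl ⟨htq, by rw [show t = ⟨q, by omega⟩ from Fin.ext htq, hQ, ← e0]⟩)
        · push Not at htp
          refine Or.inr (Or.inr ⟨⟨htp.1, htq, htp.2⟩, hoff t ht0 htp.1 htq htp.2, fun s hs hsrc => ?_⟩)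
          have ht := t.2
          rcases src_cases hsrc with ⟨h2, h3, h4, h5, hs'⟩ | ⟨hno, ⟨h1, h2, h3, hs'⟩ | ⟨h1, h2, hs'⟩ | ⟨h1, h2, hs'⟩⟩
          · -- previous position lateral
            have e : t = ⟨s.val + 1, by omega⟩ := Fin.ext (by simp; omega)
            rw [e]
            exact c1 s.val (by omega) (by omega) (by omega) (by omega) (by omega) (by omega) (by omega) (by omega)
          · have e : t = ⟨p + 1, by omega⟩ := Fin.ext (by simp; omega)
            have hs1 : u s = u ⟨p - 1, by omega⟩ := congrArg u (Fin.ext (by simp; omega))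
            rw [e, hs1]
            exact c2 h2 h3 (by omega)
          · have e : t = ⟨q + 1, by omega⟩ := Fin.ext (by simp; omega)
            have hs1 : u s = u ⟨q - 1, by omega⟩ := congrArg u (Fin.ext (by simp; omega))
            rw [e, hs1]
            rcases h2 with h2 | h2
            · have := c3 h2 (by omega)
              rw [apply_mk_congr u (show p + 1 = q - 1 by omega)] at this
              exact this
            · exact c4 h2 (by omega) (by omega)
          · have e : t = ⟨r + 1, by omega⟩ := Fin.ext (by simp; omega)
            have hs1 : u s = u ⟨q + 1, by omega⟩ := congrArg u (Fin.ext (by simp; omega))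
            rw [e, hs1]
            exact c5 h2 (by omega)

/-! ### The local family `QLoc` and its word count as a sum over skeletons -/

/-- The admissible skeleton triples `(p, q, r)` for words of length `n + 1`: `1 ≤ p`, `p + 2 ≤ q`, `q + 2 ≤ r ≤ n`.
[cite: MadrasSlade1993, §4.2 (p. 94); lane tool notion] -/
def skels (n : ℕ) : Finset (ℕ × ℕ × ℕ) :=
  (Finset.range (n + 1) ×ˢ (Finset.range (n + 1) ×ˢ Finset.range (n + 1))).filter
    fun x => 1 ≤ x.1 ∧ x.1 + 2 ≤ x.2.1 ∧ x.2.1 + 2 ≤ x.2.2 ∧ x.2.2 ≤ n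

/-- Membership in `skels`. [cite: MadrasSlade1993, §4.2 (p. 94); lane plumbing] -/
theorem mem_skels {n : ℕ} {x : ℕ × ℕ × ℕ} : x ∈ skels n ↔ 1 ≤ x.1 ∧ x.1 + 2 ≤ x.2.1 ∧ x.2.1 + 2 ≤ x.2.2 ∧ x.2.2 ≤ n := by
  unfold skels
  simp only [Finset.mem_filter, Finset.mem_product, Finset.mem_range]
  constructor
  · rintro ⟨-, h⟩; exact h
  · intro h; exact ⟨⟨by omega, by omega, by omega⟩, h⟩

/-- THE LOCAL FAMILY: skeleton words with the local exclusions (some admissible skeleton). [cite: MadrasSlade1993, §4.2 (p. 94); lane tool notion] -/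
abbrev QLoc (n : ℕ) (u : Word (n + 1) D) : Prop := ∃ x ∈ skels n, OKUpTo x.1 x.2.1 x.2.2 (n + 1) u

/-- Letter relations are type invariants. [cite: MadrasSlade1993, Definition 1.2.4; lane plumbing] -/
theorem SameType.apply_eq_iff {L E E' : ℕ} {u : Word L E} {u' : Word L E'} (h : SameType u u') (i j : Fin L) :
    u i = u j ↔ u' i = u' j := by
  rw [Prod.ext_iff, Prod.ext_iff, h.1 i j, h.2 i, h.2 j]

/-- Reversal relations are type invariants. [cite: MadrasSlade1993, Definition 1.2.4; lane plumbing] -/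
theorem SameType.apply_eq_revIdx_iff {L E E' : ℕ} {u : Word L E} {u' : Word L E'} (h : SameType u u') (i j : Fin L) :
    u i = revIdx (u j) ↔ u' i = revIdx (u' j) := by
  rw [Prod.ext_iff, Prod.ext_iff, revIdx_eq, revIdx_eq]
  simp only
  rw [h.1 i j, h.2 i, h.2 j]

/-- `IsSkel` is a type invariant. [cite: MadrasSlade1993, Definition 1.2.4; lane plumbing] -/
theorem SameType.isSkel_iff {E E' : ℕ} {u : Word (n + 1) E} {u' : Word (n + 1) E'} (h : SameType u u') (p q r : ℕ) :
    IsSkel p q r u ↔ IsSkel p q r u' := by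
  unfold IsSkel
  refine exists_congr fun hadm => ?_
  rw [h.apply_eq_iff, h.apply_eq_revIdx_iff, h.apply_eq_iff]
  refine and_congr Iff.rfl (and_congr Iff.rfl (and_congr Iff.rfl (forall_congr' fun i => ?_)))
  have e : ((u i).1 ≠ (u 0).1) ↔ ((u' i).1 ≠ (u' 0).1) := not_congr (h.1 i 0)
  rw [e]

/-- `LocalOK` is a type invariant. [cite: MadrasSlade1993, Definition 1.2.4; lane plumbing] -/
theorem SameType.localOK_iff {E E' : ℕ} {u : Word (n + 1) E} {u' : Word (n + 1) E'} (h : SameType u u') (p q r : ℕ) :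
    LocalOK p q r u ↔ LocalOK p q r u' := by
  unfold LocalOK
  simp only [Ne, h.apply_eq_revIdx_iff]

/-- `QLoc` is a type invariant. [cite: MadrasSlade1993, Definition 1.2.4; lane lemma] -/
theorem qLoc_iff_canon (u : Word (n + 1) D) : QLoc n u ↔ QLoc n (canon u) := by
  have hs := sameType_canon u
  unfold QLoc
  refine exists_congr fun x => and_congr_right fun hx => ?_
  have hadm := mem_skels.1 hx
  rw [okUpTo_iff_isSkel_localOK hadm, okUpTo_iff_isSkel_localOK hadm, hs.isSkel_iff, hs.localOK_iff]

/-- A word has at most one skeleton. [cite: MadrasSlade1993, §4.2 (p. 94); lane plumbing] -/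
theorem IsSkel.unique {p q r p' q' r' : ℕ} {u : Word (n + 1) D} (h : IsSkel p q r u) (h' : IsSkel p' q' r' u) :
    p = p' ∧ q = q' ∧ r = r' := by
  obtain ⟨hadm, -⟩ := id h
  obtain ⟨hadm', -⟩ := id h'
  have hq : q = q' := by
    have := (h.eq_rev_iff ⟨q', by omega⟩).1 ((h'.eq_rev_iff ⟨q', by omega⟩).2 rfl)
    exact this.symm
  have hp1 := (h.eq_first_iff ⟨p', by omega⟩).1 ((h'.eq_first_iff ⟨p', by omega⟩).2 (Or.inr (Or.inl rfl)))
  have hr1 := (h.eq_first_iff ⟨r', by omega⟩).1 ((h'.eq_first_iff ⟨r', by omega⟩).2 (Or.inr (Or.inr rfl)))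
  have hp2 := (h'.eq_first_iff ⟨p, by omega⟩).1 ((h.eq_first_iff ⟨p, by omega⟩).2 (Or.inr (Or.inl rfl)))
  simp only at hp1 hr1 hp2
  omega

/-- ★ THE WORD COUNT OF THE LOCAL FAMILY: `#{u ∈ Word (n+1) D : QLoc n u} = Σ_{skeletons} ∏_{t ≤ n} kappa D p q r t`.
[cite: MadrasSlade1993, §4.2 (p. 94); lane theorem] -/
theorem card_qLoc (n D : ℕ) :
    (Finset.univ.filter fun u : Word (n + 1) D => QLoc n u).card =
      ∑ x ∈ skels n, ∏ t ∈ Finset.range (n + 1), kappa D x.1 x.2.1 x.2.2 t := by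
  classical
  have hunion : (Finset.univ.filter fun u : Word (n + 1) D => QLoc n u) =
      (skels n).biUnion fun x => Finset.univ.filter (OKUpTo (D := D) x.1 x.2.1 x.2.2 (n + 1)) := by
    ext u
    simp only [QLoc, Finset.mem_filter, Finset.mem_univ, true_and, Finset.mem_biUnion]
  rw [hunion, Finset.card_biUnion]
  · refine Finset.sum_congr rfl fun x hx => ?_
    have hadm := mem_skels.1 hx
    rw [← card_okUpTo ⟨hadm.1, hadm.2.1, hadm.2.2.1⟩ (n + 1)]
  · intro x hx y hy hxy
    refine Finset.disjoint_left.2 fun u hux huy => hxy ?_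
    have hax := mem_skels.1 (Finset.mem_coe.1 hx)
    have hay := mem_skels.1 (Finset.mem_coe.1 hy)
    have h1 := ((okUpTo_iff_isSkel_localOK hax u).1 (Finset.mem_filter.1 hux).2).1
    have h2 := ((okUpTo_iff_isSkel_localOK hay u).1 (Finset.mem_filter.1 huy).2).1
    obtain ⟨e1, e2, e3⟩ := h1.unique h2
    exact Prod.ext e1 (Prod.ext e2 e3)

/-- Three distinct non-first positions cost three axes. [cite: MadrasSlade1993, Definition 1.2.4; lane plumbing] -/
theorem numAxes_le_of_atWindow_isPat_aux (u : Word (n + 1) D) {p q r : ℕ} (hadm : 1 ≤ p ∧ p + 2 ≤ q ∧ q + 2 ≤ r ∧ r ≤ n)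
    (np : ¬ IsFirst u ⟨p, by omega⟩) (nq : ¬ IsFirst u ⟨q, by omega⟩) (nr : ¬ IsFirst u ⟨r, by omega⟩) :
    numAxes u + 3 ≤ n + 1 := by
  classical
  have hp : p < n + 1 := by omega
  have hq : q < n + 1 := by omega
  have hr : r < n + 1 := by omega
  have hle := numAxes_add_card_le u {⟨p, hp⟩, ⟨q, hq⟩, ⟨r, hr⟩} (by
    intro i hi
    simp only [Finset.mem_insert, Finset.mem_singleton] at hi
    rcases hi with rfl | rfl | rfl
    · exact np
    · exact nq
    · exact nr)
  have hcard : ({⟨p, hp⟩, ⟨q, hq⟩, ⟨r, hr⟩} : Finset (Fin (n + 1))).card = 3 := by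
    rw [Finset.card_insert_of_notMem (by simp [Fin.ext_iff]; omega), Finset.card_insert_of_notMem (by simp [Fin.ext_iff]; omega),
      Finset.card_singleton]
  omega

/-- Words of the local family have at most `n − 2` axes (the three later vertical letters are non-first). [cite: MadrasSlade1993, §4.2 (p. 94); lane lemma] -/
theorem numAxes_le_of_qLoc {u : Word (n + 1) D} (h : QLoc n u) : numAxes u + 3 ≤ n + 1 := by
  classical
  obtain ⟨x, hx, hok⟩ := h
  have hadm := mem_skels.1 hx
  obtain ⟨hsk, -⟩ := (okUpTo_iff_isSkel_localOK hadm u).1 hok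
  obtain ⟨hadm', np, nq, nr⟩ := hsk.not_isFirst
  exact numAxes_le_of_atWindow_isPat_aux u hadm' np nq nr


/-- ★★ THE BRIDGE CLASS AND THE LOCAL FAMILY AGREE on words with at least `c − 2` axes (`n = c + 1`).
[cite: MadrasSlade1993, §4.2 (p. 94); lane theorem] -/
theorem qb_iff_qLoc {c : ℕ} {u : Word (n + 1) D} (hn : n = c + 1) (hax : c ≤ numAxes u + 2) : QB c u ↔ QLoc n u := by
  rw [qb_iff_exists_isSkel_localOK hn hax]
  constructor
  · rintro ⟨p, q, r, hsk, hloc⟩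
    obtain ⟨hadm, -⟩ := id hsk
    exact ⟨(p, q, r), mem_skels.2 hadm, (okUpTo_iff_isSkel_localOK hadm u).2 ⟨hsk, hloc⟩⟩
  · rintro ⟨x, hx, hok⟩
    have hadm := mem_skels.1 hx
    obtain ⟨hsk, hloc⟩ := (okUpTo_iff_isSkel_localOK hadm u).1 hok
    exact ⟨x.1, x.2.1, x.2.2, hsk, hloc⟩

/-! ### The interpolating polynomial of one skeleton and its top two coefficients -/

/-- Vertical positions `p, q, r` (position `0` is treated with the laterals: its factor is `2X`). [cite: MadrasSlade1993, §4.2 (p. 94); lane tool notion] -/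
abbrev IsVert (p q r t : ℕ) : Prop := t = p ∨ t = q ∨ t = r

/-- The root of the linear factor at a non-vertical position: `0` at position `0`, `1` at a free lateral, `3/2` at a constrained lateral.
[cite: MadrasSlade1993, §4.2 (p. 94); lane tool notion] -/
def cval (p q r t : ℕ) : ℚ := if t = 0 then 0 else if src p q r t = none then 1 else 3 / 2

/-- The monic factor at position `t`. [cite: MadrasSlade1993, §4.2 (p. 94); lane tool notion] -/
def monicF (p q r t : ℕ) : Polynomial ℚ := if IsVert p q r t then 1 else Polynomial.X - Polynomial.C (cval p q r t)

/-- The interpolating factor at position `t`: `1` at a vertical position, `2(X − cval)` otherwise. [cite: MadrasSlade1993, §4.2 (p. 94); lane tool notion] -/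
def kappaPoly (p q r t : ℕ) : Polynomial ℚ := if IsVert p q r t then 1 else Polynomial.C 2 * (Polynomial.X - Polynomial.C (cval p q r t))

/-- `kappaPoly = C β · monicF` with `β ∈ {1, 2}`. [cite: MadrasSlade1993, §4.2 (p. 94); lane plumbing] -/
theorem kappaPoly_eq (p q r t : ℕ) : kappaPoly p q r t = Polynomial.C (if IsVert p q r t then (1 : ℚ) else 2) * monicF p q r t := by
  unfold kappaPoly monicF
  split_ifs <;> simp

/-- The monic factor is monic. [cite: MadrasSlade1993, §4.2 (p. 94); lane plumbing] -/
theorem monic_monicF (p q r t : ℕ) : (monicF p q r t).Monic := by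
  unfold monicF; split_ifs
  · exact Polynomial.monic_one
  · exact Polynomial.monic_X_sub_C _

/-- Degree of the monic factor. [cite: MadrasSlade1993, §4.2 (p. 94); lane plumbing] -/
theorem natDegree_monicF (p q r t : ℕ) : (monicF p q r t).natDegree = if IsVert p q r t then 0 else 1 := by
  unfold monicF; split_ifs
  · exact Polynomial.natDegree_one
  · exact Polynomial.natDegree_X_sub_C _

/-- Second coefficient of the monic factor. [cite: MadrasSlade1993, §4.2 (p. 94); lane plumbing] -/
theorem nextCoeff_monicF (p q r t : ℕ) : (monicF p q r t).nextCoeff = if IsVert p q r t then 0 else -cval p q r t := by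
  unfold monicF; split_ifs
  · exact Polynomial.nextCoeff_C_eq_zero 1
  · exact Polynomial.nextCoeff_X_sub_C _

/-- Evaluation of the factor at `D ≥ 2` is the letter count `kappa` (for `p, q, r ≠ 0`). [cite: MadrasSlade1993, §4.2 (p. 94); lane plumbing] -/
theorem eval_kappaPoly {p q r : ℕ} (h0 : ¬ IsVert p q r 0) (t D : ℕ) (hD : 2 ≤ D) :
    (kappaPoly p q r t).eval (D : ℚ) = (kappa D p q r t : ℚ) := by
  unfold kappaPoly kappa cval
  by_cases ht0 : t = 0
  · subst ht0
    rw [if_neg h0, if_pos rfl, if_pos rfl]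
    simp
  · rw [if_neg ht0, if_neg ht0]
    by_cases hv : IsVert p q r t
    · rw [if_pos hv, if_pos hv]; simp
    · rw [if_neg hv, if_neg hv]
      by_cases hs : src p q r t = none
      · rw [if_pos hs, if_pos hs]
        push_cast [Nat.cast_sub (show 1 ≤ D by omega)]
        simp
      · rw [if_neg hs, if_neg hs]
        have h1 : 1 ≤ 2 * (D - 1) := by omega
        push_cast [Nat.cast_sub h1, Nat.cast_sub (show 1 ≤ D by omega)]
        simp; ring

/-- The interpolating polynomial of a skeleton: `∏_{t ≤ n} kappaPoly t`. [cite: MadrasSlade1993, §4.2 (p. 94); lane tool notion] -/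
def skelPoly (n p q r : ℕ) : Polynomial ℚ := ∏ t ∈ Finset.range (n + 1), kappaPoly p q r t

/-- The number of constrained lateral positions of a skeleton. [cite: MadrasSlade1993, §4.2 (p. 94); lane tool notion] -/
def bCount (n p q r : ℕ) : ℕ := ((Finset.range (n + 1)).filter fun t => t ≠ 0 ∧ ¬ IsVert p q r t ∧ src p q r t ≠ none).card

/-- Some lateral position is unconstrained (position `1` if `p ≥ 2`, else position `2`). [cite: MadrasSlade1993, §4.2 (p. 94); lane plumbing] -/
theorem exists_free_lateral {n p q r : ℕ} (hadm : 1 ≤ p ∧ p + 2 ≤ q ∧ q + 2 ≤ r ∧ r ≤ n) :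
    ∃ t, t < n + 1 ∧ t ≠ 0 ∧ ¬ IsVert p q r t ∧ src p q r t = none := by
  by_cases hp : 2 ≤ p
  · refine ⟨1, by omega, by omega, by unfold IsVert; omega, ?_⟩
    unfold src; rw [if_neg (by omega), if_neg (by omega), if_neg (by omega), if_neg (by omega)]
  · refine ⟨2, by omega, by omega, by unfold IsVert; omega, ?_⟩
    unfold src; rw [if_neg (by omega), if_neg (by omega), if_neg (by omega), if_neg (by omega)]

/-- ★ The skeleton polynomial interpolates the sequential count at every `D`. [cite: MadrasSlade1993, §4.2 (p. 94); lane lemma] -/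
theorem eval_skelPoly {n p q r : ℕ} (hadm : 1 ≤ p ∧ p + 2 ≤ q ∧ q + 2 ≤ r ∧ r ≤ n) (D : ℕ) :
    (skelPoly n p q r).eval (D : ℚ) = ((∏ t ∈ Finset.range (n + 1), kappa D p q r t : ℕ) : ℚ) := by
  unfold skelPoly
  rw [Polynomial.eval_prod]
  push_cast
  rcases Nat.lt_or_ge D 2 with hD | hD
  · -- both sides vanish: at `D = 0` the factor at `0`, at `D = 1` the factor at a free lateral position
    obtain ⟨t₁, ht₁, ht₁0, hv₁, hs₁⟩ := exists_free_lateral hadm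
    have h0v : ¬ IsVert p q r 0 := by unfold IsVert; omega
    interval_cases D
    · rw [Finset.prod_eq_zero (Finset.mem_range.2 (show 0 < n + 1 by omega)) (by unfold kappaPoly cval; rw [if_neg h0v]; simp),
        Finset.prod_eq_zero (Finset.mem_range.2 (show 0 < n + 1 by omega)) (by unfold kappa; simp)]
    · rw [Finset.prod_eq_zero (Finset.mem_range.2 ht₁) (by unfold kappaPoly cval; rw [if_neg hv₁, if_neg ht₁0, if_pos hs₁]; simp),
        Finset.prod_eq_zero (Finset.mem_range.2 ht₁) (by unfold kappa; rw [if_neg ht₁0, if_neg hv₁, if_pos hs₁]; simp)]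
  · exact Finset.prod_congr rfl fun t _ => eval_kappaPoly (by unfold IsVert; omega) t D hD

/-- Number of non-vertical positions: `n − 2`. [cite: MadrasSlade1993, §4.2 (p. 94); lane plumbing] -/
theorem card_not_isVert {n p q r : ℕ} (hadm : 1 ≤ p ∧ p + 2 ≤ q ∧ q + 2 ≤ r ∧ r ≤ n) :
    ((Finset.range (n + 1)).filter fun t => ¬ IsVert p q r t).card = n - 2 := by
  have : (Finset.range (n + 1)).filter (fun t => ¬ IsVert p q r t) = ((Finset.range (n + 1)).erase p |>.erase q).erase r := by
    ext t; simp only [Finset.mem_filter, Finset.mem_range, Finset.mem_erase, IsVert]; tauto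
  rw [this, Finset.card_erase_of_mem (by simp; omega), Finset.card_erase_of_mem (by simp; omega),
    Finset.card_erase_of_mem (by simp; omega), Finset.card_range]
  omega

/-- ★ THE TOP TWO COEFFICIENTS of the skeleton polynomial: degree `n − 2`, `[X^{n−2}] = 2^{n−2}`,
`[X^{n−3}] = −2^{n−3}·(2(n−3) + b)` with `b` the number of constrained laterals. [cite: MadrasSlade1993, §4.2 (p. 94); lane lemma] -/
theorem coeff_skelPoly {n p q r : ℕ} (hadm : 1 ≤ p ∧ p + 2 ≤ q ∧ q + 2 ≤ r ∧ r ≤ n) :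
    (skelPoly n p q r).natDegree ≤ n - 2 ∧ (skelPoly n p q r).coeff (n - 2) = (2 : ℚ) ^ (n - 2) ∧
      (skelPoly n p q r).coeff (n - 3) = -(2 : ℚ) ^ (n - 3) * (2 * ((n - 3 : ℕ) : ℚ) + (bCount n p q r : ℚ)) := by
  classical
  set S := Finset.range (n + 1) with hS
  -- the product of the monic factors
  set M : Polynomial ℚ := ∏ t ∈ S, monicF p q r t with hM
  have hmonM : M.Monic := Polynomial.monic_prod_of_monic _ _ fun t _ => monic_monicF p q r t
  have hdegM : M.natDegree = n - 2 := by
    rw [hM, Polynomial.natDegree_prod_of_monic _ _ (fun t _ => monic_monicF p q r t)]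
    rw [Finset.sum_congr rfl fun t _ => natDegree_monicF p q r t, Finset.sum_ite, Finset.sum_const_zero, zero_add,
      Finset.sum_const, smul_eq_mul, mul_one, card_not_isVert hadm]
  have hβ : ∏ t ∈ S, (if IsVert p q r t then (1 : ℚ) else 2) = 2 ^ (n - 2) := by
    rw [Finset.prod_ite, Finset.prod_const_one, one_mul, Finset.prod_const, card_not_isVert hadm]
  have hfac : skelPoly n p q r = Polynomial.C ((2 : ℚ) ^ (n - 2)) * M := by
    unfold skelPoly
    rw [Finset.prod_congr rfl fun t _ => kappaPoly_eq p q r t, Finset.prod_mul_distrib, ← map_prod Polynomial.C, hβ]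
  -- next coefficient of `M`
  have hnext : M.nextCoeff = -(((n - 3 : ℕ) : ℚ) + (bCount n p q r : ℚ) / 2) := by
    rw [hM, Polynomial.Monic.nextCoeff_prod S _ (fun t _ => monic_monicF p q r t)]
    rw [Finset.sum_congr rfl fun t _ => nextCoeff_monicF p q r t, Finset.sum_ite, Finset.sum_const_zero, zero_add]
    -- Σ over non-vertical t of −cval t
    have hsplit : ∑ t ∈ S.filter (fun t => ¬ IsVert p q r t), -cval p q r t =
        -∑ t ∈ S.filter (fun t => ¬ IsVert p q r t), cval p q r t := by rw [Finset.sum_neg_distrib]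
    rw [hsplit]
    congr 1
    -- cval = 0 at 0, = 1 + [constrained]/2 at laterals
    have hlat : ((S.filter fun t => ¬ IsVert p q r t).filter fun t => t ≠ 0).card = n - 3 := by
      rw [Finset.filter_filter]
      have : (S.filter fun t => ¬ IsVert p q r t ∧ t ≠ 0) = (S.filter fun t => ¬ IsVert p q r t).erase 0 := by
        ext t; simp only [Finset.mem_filter, Finset.mem_erase, IsVert]; tauto
      rw [this, Finset.card_erase_of_mem (by simp [hS, IsVert]; omega), card_not_isVert hadm]
      rfl
    rw [← Finset.sum_filter_add_sum_filter_not (S.filter fun t => ¬ IsVert p q r t) (fun t => t ≠ 0)]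
    have hz : ∑ t ∈ (S.filter fun t => ¬ IsVert p q r t).filter (fun t => ¬ t ≠ 0), cval p q r t = 0 :=
      Finset.sum_eq_zero fun t ht => by
        have : t = 0 := by simpa using (Finset.mem_filter.1 ht).2
        simp [cval, this]
    rw [hz, add_zero]
    have hc : ∀ t ∈ (S.filter fun t => ¬ IsVert p q r t).filter (fun t => t ≠ 0),
        cval p q r t = 1 + (if src p q r t ≠ none then (1 / 2 : ℚ) else 0) := by
      intro t ht
      have ht0 : t ≠ 0 := (Finset.mem_filter.1 ht).2
      unfold cval; rw [if_neg ht0]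
      by_cases hs : src p q r t = none
      · simp [hs]
      · rw [if_neg hs, if_pos hs]; norm_num
    rw [Finset.sum_congr rfl hc, Finset.sum_add_distrib, Finset.sum_const, hlat, Finset.sum_ite, Finset.sum_const_zero, add_zero,
      Finset.sum_const, nsmul_eq_mul, nsmul_eq_mul]
    unfold bCount
    rw [hS, Finset.filter_filter, Finset.filter_filter]
    have : (Finset.range (n + 1)).filter (fun t => ¬ IsVert p q r t ∧ t ≠ 0 ∧ src p q r t ≠ none) =
        (Finset.range (n + 1)).filter (fun t => t ≠ 0 ∧ ¬ IsVert p q r t ∧ src p q r t ≠ none) :=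
      Finset.filter_congr fun t _ => by tauto
    rw [this]
    ring
  refine ⟨?_, ?_, ?_⟩
  · rw [hfac, Polynomial.natDegree_C_mul (by positivity), hdegM]
  · rw [hfac, Polynomial.coeff_C_mul]
    have : M.coeff (n - 2) = 1 := by
      have h := hmonM; rw [Polynomial.Monic, Polynomial.leadingCoeff, hdegM] at h; exact h
    rw [this, mul_one]
  · rw [hfac, Polynomial.coeff_C_mul]
    rcases Nat.lt_or_ge n 3 with hn | hn
    · omega
    · have : M.coeff (n - 3) = M.nextCoeff := by
        rw [Polynomial.nextCoeff_of_natDegree_pos (by rw [hdegM]; omega), hdegM, show n - 2 - 1 = n - 3 by omega]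
      rw [this, hnext, show n - 2 = (n - 3) + 1 by omega, pow_succ]
      push_cast [Nat.cast_sub hn]
      ring

/-! ### The interpolating polynomial of the local family and the two top canonical counts -/

/-- The interpolating polynomial of the local family: the sum of the skeleton polynomials. [cite: MadrasSlade1993, §4.2 (p. 94); lane tool notion] -/
def locPoly (n : ℕ) : Polynomial ℚ := ∑ x ∈ skels n, skelPoly n x.1 x.2.1 x.2.2

/-- ★ `locPoly` interpolates the word count of the local family at every `D`. [cite: MadrasSlade1993, §4.2 (p. 94); lane lemma] -/
theorem eval_locPoly (n D : ℕ) : (locPoly n).eval (D : ℚ) = ((Finset.univ.filter fun u : Word (n + 1) D => QLoc n u).card : ℚ) := by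
  rw [card_qLoc, locPoly, Polynomial.eval_finsetSum]
  push_cast
  exact Finset.sum_congr rfl fun x hx => by rw [eval_skelPoly (mem_skels.1 hx) D]; push_cast; rfl

/-- ★ The top two coefficients of `locPoly`. [cite: MadrasSlade1993, §4.2 (p. 94); lane lemma] -/
theorem coeff_locPoly (n : ℕ) :
    (locPoly n).natDegree ≤ n - 2 ∧ (locPoly n).coeff (n - 2) = (2 : ℚ) ^ (n - 2) * (skels n).card ∧
      (locPoly n).coeff (n - 3) = -(2 : ℚ) ^ (n - 3) * ∑ x ∈ skels n, (2 * ((n - 3 : ℕ) : ℚ) + (bCount n x.1 x.2.1 x.2.2 : ℚ)) := by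
  refine ⟨?_, ?_, ?_⟩
  · unfold locPoly
    exact Polynomial.natDegree_sum_le_of_forall_le _ _ fun x hx => (coeff_skelPoly (mem_skels.1 hx)).1
  · rw [locPoly, Polynomial.finsetSum_coeff, Finset.sum_congr rfl fun x hx => (coeff_skelPoly (mem_skels.1 hx)).2.1, Finset.sum_const,
      nsmul_eq_mul, mul_comm]
  · rw [locPoly, Polynomial.finsetSum_coeff, Finset.sum_congr rfl fun x hx => (coeff_skelPoly (mem_skels.1 hx)).2.2, ← Finset.mul_sum]

/-- ★★ THE TWO TOP CANONICAL COUNTS OF THE LOCAL FAMILY: with `n − 2` axes, `2^{n−2}·#skeletons`; with `n − 3` axes,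
`2^{n−2}·C(n−2,2)·#skeletons − 2^{n−3}·Σ_skel (2(n−3) + b)`. [cite: MadrasSlade1993, §4.2 (p. 94); lane theorem] -/
theorem card_canonical_qLoc (n : ℕ) (hn : 5 ≤ n) :
    ((Finset.univ.filter fun τ : Word (n + 1) (n + 1) => canon τ = τ ∧ QLoc n τ ∧ numAxes τ = n - 2).card : ℚ) =
        (2 : ℚ) ^ (n - 2) * (skels n).card ∧
    ((Finset.univ.filter fun τ : Word (n + 1) (n + 1) => canon τ = τ ∧ QLoc n τ ∧ numAxes τ = n - 3).card : ℚ) =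
        -(2 : ℚ) ^ (n - 3) * (∑ x ∈ skels n, (2 * ((n - 3 : ℕ) : ℚ) + (bCount n x.1 x.2.1 x.2.2 : ℚ))) +
          ((n - 2).choose 2 : ℕ) * ((2 : ℚ) ^ (n - 2) * (skels n).card) := by
  obtain ⟨hdeg, hc1, hc2⟩ := coeff_locPoly n
  have H := card_canonical_numAxes_eq_coeff (L := n + 1) (fun D (u : Word (n + 1) D) => QLoc n u) (fun D u => qLoc_iff_canon u)
    (m := n - 2) (by omega) (fun τ _ hq => by have := numAxes_le_of_qLoc hq; omega) (locPoly n) (fun D => (eval_locPoly n D).symm)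
  obtain ⟨H1, H2⟩ := H
  refine ⟨by rw [H1, hc1], ?_⟩
  rw [show n - 3 = n - 2 - 1 by omega, H2 (by omega), show n - 2 - 1 = n - 3 by omega, hc2, hc1]

/-! ### The bridge-class side: canonical counts of `QB c` and the axis classes `F_{c,c+2}(u)` -/

/-- A nonempty word has an axis. [cite: MadrasSlade1993, Definition 1.2.4; lane plumbing] -/
theorem numAxes_pos {L E : ℕ} (u : Word (L + 1) E) : 0 < numAxes u := by
  unfold numAxes firsts
  exact Finset.card_pos.2 ⟨0, Finset.mem_filter.2 ⟨Finset.mem_univ _, fun q hq _ => absurd hq (Fin.not_lt_zero q)⟩⟩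

/-- The axis class `F_{c,n}(u)` of the cost census (inline, as in `costCoeffZd_eq_sum_choose_mul`). [cite: MadrasSlade1993, §4.2 eq. (4.2.20)–(4.2.22); lane tool notion] -/
def axisClassCard (c n u : ℕ) : ℕ :=
  ((irreducibleBridges (u + 1) n).filter fun (ω : ℕ → Site (u + 1)) => costZd u n ω = c ∧
    ∀ a : Fin (u + 1), a ≠ 0 → ∃ i ≤ n, ω i a ≠ (0 : ℤ)).card

open Classical in
/-- ★ THE COST CENSUS IN THE FALLING-FACTORIAL BASIS: for every `D ≥ 1`,
`#{u ∈ Word (n+1) D : QB c u} = Σ_u (2·F_{c,n+1}(u)/u!) · D^{(u+1)}`. [cite: MadrasSlade1993, §4.2 eq. (4.2.20)–(4.2.22); lane lemma] -/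
theorem card_qb_eq_sum_descFactorial (c n d : ℕ) :
    ((Finset.univ.filter fun u : Word (n + 1) (d + 1) => QB c u).card : ℚ) =
      ∑ u ∈ Finset.range (c + 1), (2 * (axisClassCard c (n + 1) u : ℚ) / u.factorial) * ((d + 1).descFactorial (u + 1) : ℕ) := by
  classical
  rw [card_qb_eq_mul, ← costCoeffZd_eq_card_qb, costCoeffZd_eq_sum_choose_mul]
  push_cast
  rw [Finset.mul_sum]
  refine Finset.sum_congr rfl fun u _ => ?_
  unfold axisClassCard
  have h1 : ((d + 1).descFactorial (u + 1) : ℚ) = (d + 1 : ℚ) * (u.factorial : ℚ) * (d.choose u : ℚ) := by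
    rw [Nat.succ_descFactorial_succ, Nat.descFactorial_eq_factorial_mul_choose]; push_cast; ring
  rw [h1]
  have hf : (u.factorial : ℚ) ≠ 0 := by positivity
  field_simp

/-- READING COUNTS OFF A FALLING-FACTORIAL EXPANSION, rational coefficients (the `ℚ`-valued form of
`eq_coeff_of_sum_descFactorial`). [cite: MadrasSlade1993, §1.1 eq. (1.1.8) p. 5; lane lemma] -/
theorem eq_coeff_of_sum_descFactorial_rat (N : ℕ → ℚ) {m M : ℕ} (hmM : m ≤ M) (hN : ∀ j, m < j → j ≤ M → N j = 0)
    (P : Polynomial ℚ) (h : ∀ D : ℕ, ∑ j ∈ Finset.range (M + 1), N j * (D.descFactorial j : ℕ) = P.eval (D : ℚ)) :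
    N m = P.coeff m ∧ (1 ≤ m → N (m - 1) = P.coeff (m - 1) + (m.choose 2 : ℕ) * N m) := by
  classical
  set S : Polynomial ℚ := ∑ j ∈ Finset.range (M + 1), Polynomial.C (N j) * descPochhammer ℚ j with hS
  have hSP : S = P := by
    refine poly_eq_of_eval_natCast_eq fun D => ?_
    rw [← h D, hS, Polynomial.eval_finsetSum]
    refine Finset.sum_congr rfl fun j _ => ?_
    rw [Polynomial.eval_C_mul, descPochhammer_eval_eq_descFactorial]
  have hcoeff : ∀ k, P.coeff k = ∑ j ∈ Finset.range (M + 1), N j * (descPochhammer ℚ j).coeff k := by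
    intro k
    rw [← hSP, hS, Polynomial.finsetSum_coeff]
    exact Finset.sum_congr rfl fun j _ => by rw [Polynomial.coeff_C_mul]
  have hvan : ∀ k, m ≤ k + 1 → ∀ j ∈ Finset.range (M + 1), j ≠ k → j ≠ k + 1 → N j * (descPochhammer ℚ j).coeff k = 0 := by
    intro k hk j hj hjk hjk1
    rcases lt_or_gt_of_ne hjk with hlt | hgt
    · rw [descPochhammer_coeff_of_lt hlt, mul_zero]
    · rw [hN j (by omega) (by have := Finset.mem_range.1 hj; omega), zero_mul]
  have hm_mem : m ∈ Finset.range (M + 1) := Finset.mem_range.2 (by omega)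
  constructor
  · rw [hcoeff m, ← Finset.add_sum_erase _ _ hm_mem, descPochhammer_coeff_self, mul_one]
    rw [Finset.sum_eq_zero fun j hj => ?_, add_zero]
    have hjm : j ≠ m := Finset.ne_of_mem_erase hj
    have hj' := Finset.mem_of_mem_erase hj
    by_cases hj1 : j = m + 1
    · rw [hj1, hN (m + 1) (by omega) (by have := Finset.mem_range.1 hj'; omega), zero_mul]
    · exact hvan m (by omega) j hj' hjm hj1
  · intro hm1
    obtain ⟨m', rfl⟩ : ∃ m', m = m' + 1 := ⟨m - 1, by omega⟩
    rw [show m' + 1 - 1 = m' by omega]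
    have hm'_mem : m' ∈ (Finset.range (M + 1)).erase (m' + 1) := Finset.mem_erase.2 ⟨by omega, Finset.mem_range.2 (by omega)⟩
    rw [hcoeff m', ← Finset.add_sum_erase _ _ hm_mem, ← Finset.add_sum_erase _ _ hm'_mem, descPochhammer_coeff_pred,
      descPochhammer_coeff_self, mul_one, Finset.sum_eq_zero fun j hj => ?_]
    · ring
    · have hj1 : j ≠ m' := Finset.ne_of_mem_erase hj
      have hj2 := Finset.mem_of_mem_erase hj
      have hj3 : j ≠ m' + 1 := Finset.ne_of_mem_erase hj2
      exact hvan m' (by omega) j (Finset.mem_of_mem_erase hj2) hj1 hj3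

open Classical in
/-- ★★ THE SECOND AXIS CLASS AS A CANONICAL COUNT: `2·F_{c,c+2}(c−3)/(c−3)! = #{canonical τ : QB c τ, numAxes τ = c − 2}` (and the same
one order up), by comparing the two falling-factorial expansions of `#{QB c}` (`n = c + 1`, `c ≥ 4`).
[cite: MadrasSlade1993, §4.2 eq. (4.2.20)–(4.2.22); lane theorem] -/
theorem axisClassCard_eq_card_canonical {c n : ℕ} (hn : n = c + 1) (hc : 4 ≤ c) :
    2 * (axisClassCard c (n + 1) (c - 3) : ℚ) / (c - 3).factorial =
      ((Finset.univ.filter fun τ : Word (n + 1) (n + 1) => canon τ = τ ∧ QB c τ ∧ numAxes τ = n - 3).card : ℚ) := by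
  classical
  -- the canonical counts `M_j` of `QB c`
  set M : ℕ → ℕ := fun j => (Finset.univ.filter fun τ : Word (n + 1) (n + 1) => canon τ = τ ∧ QB c τ ∧ numAxes τ = j).card with hMdef
  -- the `F`-side coefficients
  set NF : ℕ → ℚ := fun j => if j = 0 then 0 else 2 * (axisClassCard c (n + 1) (j - 1) : ℚ) / (j - 1).factorial with hNF
  set P : Polynomial ℚ := ∑ j ∈ Finset.range (n + 2), Polynomial.C (M j : ℚ) * descPochhammer ℚ j with hP
  have hevalM : ∀ D : ℕ, ∑ j ∈ Finset.range (n + 2), (M j : ℚ) * (D.descFactorial j : ℕ) = P.eval (D : ℚ) := by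
    intro D
    rw [hP, Polynomial.eval_finsetSum]
    exact Finset.sum_congr rfl fun j _ => by rw [Polynomial.eval_C_mul, descPochhammer_eval_eq_descFactorial]
  -- `M` is the numAxes-profile of `QB c` (master formula), `M_j = 0` above `n − 2`, `M_0 = 0`
  have hMsum : ∀ D : ℕ, ((Finset.univ.filter fun u : Word (n + 1) D => QB c u).card : ℚ) =
      ∑ j ∈ Finset.range (n + 2), (M j : ℚ) * (D.descFactorial j : ℕ) := by
    intro D
    rw [card_filter_eq_sum_numAxes (QB c) (QB c) (fun u => qb_iff_canon c u)]
    push_cast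
    refine Finset.sum_congr rfl fun j _ => ?_
    rw [hMdef]
    simp only [canonWords, Finset.filter_filter]
  have hMvan : ∀ j, n - 2 < j → j ≤ n + 1 → M j = 0 := by
    intro j hj _
    rw [hMdef]; simp only
    rw [Finset.card_eq_zero, Finset.filter_eq_empty_iff]
    rintro τ - ⟨-, hq, hj'⟩
    have := numAxes_le_of_qb hn hq
    omega
  have hM0 : M 0 = 0 := by
    rw [hMdef]; simp only
    rw [Finset.card_eq_zero, Finset.filter_eq_empty_iff]
    rintro τ - ⟨-, -, hj'⟩
    have := numAxes_pos τ
    omega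
  -- the `F` side: same values at every `D`
  have hFvan : ∀ j, n - 2 < j → j ≤ n + 1 → NF j = 0 := by
    intro j hj _
    rw [hNF]; simp only
    rw [if_neg (by omega)]
    have : axisClassCard c (n + 1) (j - 1) = 0 := by
      unfold axisClassCard
      exact card_allAxesClass_eq_zero_of_lt (by omega)
    rw [this]; simp
  have hevalF : ∀ D : ℕ, ∑ j ∈ Finset.range (n + 2), NF j * (D.descFactorial j : ℕ) = P.eval (D : ℚ) := by
    intro D
    rw [← hevalM D]
    rcases Nat.eq_zero_or_pos D with rfl | hD
    · -- both sides reduce to the `j = 0` term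
      have hz : ∀ j ∈ Finset.range (n + 2), j ≠ 0 → ((Nat.descFactorial 0 j : ℕ) : ℚ) = 0 := by
        intro j _ hj
        obtain ⟨j', rfl⟩ : ∃ j', j = j' + 1 := ⟨j - 1, by omega⟩
        simp
      rw [Finset.sum_eq_single 0 (fun j hj hj0 => by rw [hz j hj hj0, mul_zero]) (by simp),
        Finset.sum_eq_single 0 (fun j hj hj0 => by rw [hz j hj hj0, mul_zero]) (by simp)]
      simp [hNF, hM0]
    · obtain ⟨d, rfl⟩ : ∃ d, D = d + 1 := ⟨D - 1, by omega⟩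
      rw [← hMsum (d + 1), card_qb_eq_sum_descFactorial]
      -- reindex `j = u + 1`
      rw [Finset.sum_range_succ' (fun j => NF j * (((d + 1).descFactorial j : ℕ) : ℚ))]
      have h0 : NF 0 * (((d + 1).descFactorial 0 : ℕ) : ℚ) = 0 := by simp [hNF]
      rw [h0, add_zero]
      have hsub : Finset.range (c + 1) ⊆ Finset.range (n + 1) := fun x hx => Finset.mem_range.2 (by have := Finset.mem_range.1 hx; omega)
      rw [← Finset.sum_subset hsub (fun u hu hu' => ?_)]
      · refine Finset.sum_congr rfl fun u _ => ?_
        rw [hNF]; simp only [Nat.add_sub_cancel, Nat.add_eq_zero_iff, one_ne_zero, and_false, if_false]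
      · have : axisClassCard c (n + 1) u = 0 := by
          unfold axisClassCard
          exact card_allAxesClass_eq_zero_of_lt (by have := Finset.mem_range.1 hu; simp at hu'; omega)
        rw [hNF]; simp [this]
  obtain ⟨A1, A2⟩ := eq_coeff_of_sum_descFactorial_rat (fun j => (M j : ℚ)) (m := n - 2) (M := n + 1) (by omega)
    (fun j hj hj' => by rw [hMvan j hj hj']; simp) P hevalM
  obtain ⟨B1, B2⟩ := eq_coeff_of_sum_descFactorial_rat NF (m := n - 2) (M := n + 1) (by omega) hFvan P hevalF
  have e1 : NF (n - 2) = (M (n - 2) : ℚ) := by rw [B1, A1]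
  have e2 : NF (n - 2 - 1) = (M (n - 2 - 1) : ℚ) := by rw [B2 (by omega), A2 (by omega), e1]
  rw [show n - 2 - 1 = n - 3 by omega] at e2
  rw [hNF, hMdef] at e2
  simp only at e2
  rw [if_neg (by omega), show n - 3 - 1 = c - 3 by omega] at e2
  exact e2

open Classical in
/-- ★★★ THE SECOND AXIS CLASS OF THE SPAN-TWO CELL REDUCED TO TWO FINITE SUMS OVER SKELETONS: for `c ≥ 4`, `n = c + 1`,
`2·F_{c,c+2}(c−3)/(c−3)! = C(n−2,2)·2^{n−2}·#skels(n) − 2^{n−3}·Σ_{skels(n)} (2(n−3) + bCount)` — the bridge class and the local family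
have the same canonical words with `c − 2` axes, and the local family is counted by the planted-skeleton polynomial.
[cite: MadrasSlade1993, §4.2 eq. (4.2.20)–(4.2.22); §1.1 eq. (1.1.8) p. 5; lane theorem] -/
theorem axisClassCard_second_eq_skeleton_sums {c n : ℕ} (hn : n = c + 1) (hc : 4 ≤ c) :
    2 * (axisClassCard c (n + 1) (c - 3) : ℚ) / (c - 3).factorial =
      -(2 : ℚ) ^ (n - 3) * (∑ x ∈ skels n, (2 * ((n - 3 : ℕ) : ℚ) + (bCount n x.1 x.2.1 x.2.2 : ℚ))) +
        ((n - 2).choose 2 : ℕ) * ((2 : ℚ) ^ (n - 2) * (skels n).card) := by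
  rw [axisClassCard_eq_card_canonical hn hc, ← (card_canonical_qLoc n (by omega)).2]
  congr 1
  refine congrArg Finset.card (Finset.filter_congr fun τ _ => ?_)
  constructor
  · rintro ⟨h1, h2, h3⟩; exact ⟨h1, (qb_iff_qLoc hn (by omega)).1 h2, h3⟩
  · rintro ⟨h1, h2, h3⟩; exact ⟨h1, (qb_iff_qLoc hn (by omega)).2 h2, h3⟩

end SkeletonCount

end WordTypes

end Literature.Probability.RandomPlanarGeometry.SAW.Zd

end
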